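import Summits.QuantumFields.BalabanUV.T4Continuum.Spine.NE9.DirectPairingFamily
import Summits.QuantumFields.BalabanUV.T4Continuum.Spine.NE9.DirectPairingCauchy
import Summits.QuantumFields.BalabanUV.T4Continuum.Spine.NE9.TowerCarriersBox

/-!
# T⁴ programme, spine estimate NE9 — KING'S CURRENCY ON THE TOWER OF CARRIERS, BY NAME: `TowerCarriersBox.TowerNE5On` + prefix dependence
# + SEPARATE UNIFORM CONTINUITY of every scale-`m` term in each young coupling (per scale, uniformly over the domains, backgrounds and runs of
# that scale) ⇒ the DIRECT bracket of the runs `k` and `k + n` at every domain tends to zero with the scale, uniformly in `n`, hence a scale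
# profile `b_j → 0` dominating node U3's direct bracket and `T4CauchySum.delta E₀ ρ inj → 0` for every injection under it — census item C30 of
# cell `pub-balaban-gaps`, seat ne9 (gen 6), the junction (abstract E-side: `DirectPairing`∕`DirectPairingFamily`; U6: `DirectPairingCauchy`)

Cell `pub-balaban-gaps` (YM blitz G2, seat ne9, unit `pub-balaban-gaps-ne9-g6`; record `run/shared/lean/pub/pub-balaban-gaps/ne/NE9.md` §5 row
C30).  Summits-side bookkeeping; ONE definition (`kingSection`, the section of the tower of carriers at a top run, background and domain,
extended above its top by gen 4's `TowerCarriers.extendTower` — the object the family theorems are applied to).  By-name inputs: gen 4's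
`TowerCarriers` (`TowerData`, `descend`, `extendTower`), gen 5's `TowerCarriersBox` (`TowerNE5On`, `rate_of_towerNE5On`, box-window closure),
this gen's `DirectPairingFamily.directBracket_eventually_le_family`, `DirectPairing.abs_sub_le_tail_of_consecutive` ∕ `tendsto_tail` and
`DirectPairingCauchy.tendsto_delta_of_profile`.

WHAT IS PROVED.  §1 the section `kingSection T E κ k U X` (`m ↦ e^{κd(X)}·E (r X + m) g (descend k U (r X + m)) X` up to the top `m₀ = k − r X`,
aged-history extension above; the zero tower when `r X > k`) inherits: the tower rate from `TowerNE5On` (`kingSection_rate`), prefix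
dependence from prefix dependence of `E` (`kingSection_prefix`), and separate uniform continuity with moduli UNIFORM OVER ALL SECTIONS from the
carriers-level hypothesis «for every scale `m`, coordinate `i < m` and `ε > 0` one `δ > 0` serves every run `k`, background `U` and domain
`X` of scale `m` (`r X + m = k`)» (`kingSection_sepUC`; above the top the aged coordinate has the same AGE, so a finite minimum over the tops
suffices).  §2 `directBracket_eventually_le_carriers`: `TowerNE5On` + prefix dependence + that hypothesis + a profile `P_i → 0` ⇒ for every
`η > 0` ONE scale threshold `M₀` such that for ALL runs `k`, gaps `n`, backgrounds `U`, domains `X` of scale `≥ M₀` in run `k` and admissible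
pairs with `|g_{i+n} − g'_i| ≤ P_i`: `|E (k+n) g U X − E k g' (descend (k+n) U k) X| ≤ η·e^{−κd(X)}`.  §3 with a level-uniform (1.18)-type
bound `e^{κd(X)}|E k g U X| ≤ B̄`: a nonnegative scale profile `b_j → 0` (a supremum) dominating ALL these direct brackets
(`exists_profile_carriers`), and the U6 end `king_U6_of_carriers`: along a family of run histories `t K ∈ BoxWindow I` with a summable K-uniform
CONSECUTIVE matching profile (node U2's output; the direct profile is its tail), every injection `0 ≤ inj K j ≤ b_j` has
`T4CauchySum.delta E₀ ρ inj K → 0` — the remainder King's organisation of node U6 consumes (`DirectPairingCauchy.cauchySeq_genFun_of_unif`).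

HONEST FRAMING: bookkeeping for rung (B)+1 on a FIXED finite four-torus; hypothesis SHAPES over `T4OutputRate.NE5` BY NAME; tower-NE5 is the
cell's estimate NE5 (NOT PRINTED, NOT PROVED); the separate-uniform-continuity hypothesis is of printed TYPE for the LAST coupling only
([Balaban1987RG1] p. 263 *"It is a C^∞-function of g_{j−1} ∈ [0, γ]"*), its uniformity over runs is the printed KIND of uniformity (Thm 1
p. 259 *"uniformly in the lattice spacing"*) read for a qualitative modulus (H-reading); nothing is instantiated on Bałaban's objects (instance
0∕1); spine PROVED 0∕9 unchanged; NOT UV stability, NOT the continuum limit, NOT infinite volume, NOT a mass gap, NOT Clay.  Classification of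
NE9 UNCHANGED in kind (WORK-bound on W1).  PRICE OF THE CURRENCY (not typed here): node U5∕U6's other producers for the pair (K, K+n), n-uniform.

References (TYPES only): [Balaban1987RG1] = T. Bałaban, Commun. Math. Phys. **109** (1987) 249–301, Thm 1 p. 259, p. 263; [King1986] = C. King,
Commun. Math. Phys. **102** (1986) 649–677, §3.2 pp. 656–657.
-/

namespace Summit.QuantumFields.BalabanUV.T4Continuum.NE9.TowerCarriersKing

open scoped BigOperators
open Finset Filter Topology
open Literature.MathematicalPhysics.QuantumFieldTheory.Balaban1983to89
open Literature.MathematicalPhysics.QuantumFieldTheory.Balaban1983to89.T4CouplingAnalyticity (BoxWindow)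
open T4CauchySum (delta)
open Summit.QuantumFields.BalabanUV.T4Continuum.NE9.TowerCarriers
open Summit.QuantumFields.BalabanUV.T4Continuum.NE9.TowerCarriersBox
  (TowerNE5On rate_of_towerNE5On shift_mem_boxWindow mix_mem_boxWindow age_mem_boxWindow)
open Summit.QuantumFields.BalabanUV.T4Continuum.NE9.DirectPairing (abs_sub_le_tail_of_consecutive tendsto_tail)
open Summit.QuantumFields.BalabanUV.T4Continuum.NE9.DirectPairingFamily (directBracket_eventually_le_family)
open Summit.QuantumFields.BalabanUV.T4Continuum.NE9.DirectPairingCauchy (tendsto_delta_of_profile)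

/-! ## §1 The section of the tower of carriers at a top run, background and domain -/

/-- **THE SECTION** at top run `k`, run-`k` background `U` and domain `X`: for `r X ≤ k`, the tower `m ↦ e^{κd(X)}·E (r X + m) g (descend k U (r X + m)) X`
of the terms of the runs `r X, …, k` at the descended backgrounds, extended above its top `k − r X` by ageing the history (`TowerCarriers.extendTower`);
the zero tower when `r X > k`.  The object `DirectPairingFamily` is applied to; it asserts nothing. [folklore] -/
noncomputable def kingSection (T : TowerData) (E : ℕ → (ℕ → ℝ) → T.B → T.Dom → ℝ) (κ : ℝ) (k : ℕ) (U : T.B) (X : T.Dom) :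
    ℕ → (ℕ → ℝ) → ℝ :=
  if T.r X ≤ k then
    extendTower (k - T.r X) (fun m g => Real.exp (κ * T.d X) * E (T.r X + m) g (T.descend k U (T.r X + m)) X)
  else fun _ _ => 0

variable (T : TowerData) {E : ℕ → (ℕ → ℝ) → T.B → T.Dom → ℝ} {I : Set ℝ} {κ : ℝ}

/-- Below the top the section is the genuine term of run `r X + m`. [folklore] -/
theorem kingSection_of_le {k : ℕ} {U : T.B} {X : T.Dom} (hX : T.r X ≤ k) {m : ℕ} (hm : m ≤ k - T.r X) (g : ℕ → ℝ) :
    kingSection T E κ k U X m g = Real.exp (κ * T.d X) * E (T.r X + m) g (T.descend k U (T.r X + m)) X := by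
  unfold kingSection
  rw [if_pos hX, extendTower_of_le _ hm]

/-- Above the top the section is the top term on the aged history. [folklore] -/
theorem kingSection_of_lt {k : ℕ} {U : T.B} {X : T.Dom} (hX : T.r X ≤ k) {m : ℕ} (hm : k - T.r X < m) (g : ℕ → ℝ) :
    kingSection T E κ k U X m g = Real.exp (κ * T.d X) * E k (fun i => g (i + (m - (k - T.r X)))) U X := by
  unfold kingSection
  rw [if_pos hX, extendTower_of_lt _ hm, show T.r X + (k - T.r X) = k by omega, T.descend_top]

/-- The degenerate sections (`r X > k`: the domain does not yet exist in run `k`) are zero. [folklore] -/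
theorem kingSection_of_not_le {k : ℕ} {U : T.B} {X : T.Dom} (hX : ¬ T.r X ≤ k) (m : ℕ) (g : ℕ → ℝ) :
    kingSection T E κ k U X m g = 0 := by
  unfold kingSection
  rw [if_neg hX]

/-- **THE SECTION INHERITS THE TOWER RATE** from `TowerNE5On` (one level = `rate_of_towerNE5On` at the descended background, `tr_descend`;
above the top `extendTower_rate`). [folklore] -/
theorem kingSection_rate {θ C₅ : ℝ} (hC : 0 ≤ C₅) (hθ : 0 ≤ θ) (h5 : TowerNE5On T E I κ θ C₅)
    (k : ℕ) (U : T.B) (X : T.Dom) :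
    ∀ m, ∀ g ∈ BoxWindow I,
      |kingSection T E κ k U X (m + 1) g - kingSection T E κ k U X m (fun i => g (i + 1))| ≤ C₅ * θ ^ m := by
  by_cases hX : T.r X ≤ k
  · have hpos : 0 < Real.exp (κ * T.d X) := Real.exp_pos _
    have h := extendTower_rate (W := BoxWindow I) (M₀ := k - T.r X)
      (F := fun m g => Real.exp (κ * T.d X) * E (T.r X + m) g (T.descend k U (T.r X + m)) X) hC hθ
      (fun m hm g hg => by
        have hn : T.r X + m < k := by omega
        have hrate := rate_of_towerNE5On T h5 (T.r X + m) hg (T.descend k U (T.r X + m + 1)) X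
        rw [T.tr_descend hn, Nat.add_sub_cancel_left] at hrate
        rw [← mul_sub, abs_mul, abs_of_pos hpos, show T.r X + (m + 1) = T.r X + m + 1 from rfl]
        calc Real.exp (κ * T.d X) * |E (T.r X + m + 1) g (T.descend k U (T.r X + m + 1)) X -
                E (T.r X + m) (fun i => g (i + 1)) (T.descend k U (T.r X + m)) X|
            ≤ Real.exp (κ * T.d X) * (C₅ * θ ^ m * Real.exp (-(κ * T.d X))) :=
              mul_le_mul_of_nonneg_left hrate hpos.le
          _ = C₅ * θ ^ m := by
              rw [Real.exp_neg]
              field_simp)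
    intro m g hg
    unfold kingSection
    rw [if_pos hX]
    exact h m g hg
  · intro m g _
    rw [kingSection_of_not_le T hX, kingSection_of_not_le T hX, sub_self, abs_zero]
    positivity

/-- **THE SECTION INHERITS PREFIX DEPENDENCE**: if the scale-`(k − r X)` term of run `k` reads only the couplings below its scale, every level of
every section reads only the couplings below its level. [folklore] -/
theorem kingSection_prefix
    (hP : ∀ (k : ℕ) (U : T.B) (X : T.Dom), ∀ g ∈ BoxWindow I, ∀ g' ∈ BoxWindow I,
      (∀ i, i < k - T.r X → g i = g' i) → E k g U X = E k g' U X)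
    (k : ℕ) (U : T.B) (X : T.Dom) :
    ∀ m, ∀ g ∈ BoxWindow I, ∀ g' ∈ BoxWindow I, (∀ i, i < m → g i = g' i) →
      kingSection T E κ k U X m g = kingSection T E κ k U X m g' := by
  intro m g hg g' hg' hagree
  by_cases hX : T.r X ≤ k
  · rcases le_or_gt m (k - T.r X) with hm | hm
    · rw [kingSection_of_le T hX hm, kingSection_of_le T hX hm,
        hP (T.r X + m) _ X g hg g' hg' (fun i hi => hagree i (by omega))]
    · rw [kingSection_of_lt T hX hm, kingSection_of_lt T hX hm,
        hP k U X _ (age_mem_boxWindow hg _) _ (age_mem_boxWindow hg' _) (fun i hi => hagree _ (by omega))]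
  · rw [kingSection_of_not_le T hX, kingSection_of_not_le T hX]

/-- **THE SECTIONS INHERIT SEPARATE UNIFORM CONTINUITY, UNIFORMLY OVER ALL SECTIONS**, from the carriers-level hypothesis: for every scale `m`,
coordinate `i < m` and `ε > 0` one `δ > 0` serving EVERY run `k`, background `U` and domain `X` of scale `m` in run `k` (`r X + m = k`).  Below the
top a section level IS such a term; above the top it is the top term on the aged history, whose aged coordinate has the same AGE `m − i` — so
the finite minimum of the moduli at `(m₀, m₀ − (m − i))`, `m₀ ≤ m`, serves. [folklore] -/
theorem kingSection_sepUC
    (hUC : ∀ m i : ℕ, i < m → ∀ ε : ℝ, 0 < ε → ∃ δ : ℝ, 0 < δ ∧ ∀ (k : ℕ) (U : T.B) (X : T.Dom), T.r X + m = k →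
      ∀ g ∈ BoxWindow I, ∀ g' ∈ BoxWindow I, (∀ j, j ≠ i → g j = g' j) → |g i - g' i| ≤ δ →
        Real.exp (κ * T.d X) * |E k g U X - E k g' U X| ≤ ε) :
    ∀ m i : ℕ, i < m → ∀ ε : ℝ, 0 < ε → ∃ δ : ℝ, 0 < δ ∧ ∀ s : ℕ × T.B × T.Dom, ∀ g ∈ BoxWindow I, ∀ g' ∈ BoxWindow I,
      (∀ j, j ≠ i → g j = g' j) → |g i - g' i| ≤ δ →
        |kingSection T E κ s.1 s.2.1 s.2.2 m g - kingSection T E κ s.1 s.2.1 s.2.2 m g'| ≤ ε := by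
  intro m i hi ε hε
  -- the age `a = m − i ≥ 1`; moduli of the genuine terms at `(m₀, m₀ − a)`, `a ≤ m₀` (dummy below `a`)
  have hmod : ∀ m₀ : ℕ, ∃ δ : ℝ, 0 < δ ∧ (m - i ≤ m₀ → ∀ (k : ℕ) (U : T.B) (X : T.Dom), T.r X + m₀ = k →
      ∀ g ∈ BoxWindow I, ∀ g' ∈ BoxWindow I, (∀ j, j ≠ m₀ - (m - i) → g j = g' j) →
        |g (m₀ - (m - i)) - g' (m₀ - (m - i))| ≤ δ → Real.exp (κ * T.d X) * |E k g U X - E k g' U X| ≤ ε) := by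
    intro m₀
    by_cases h : m - i ≤ m₀
    · obtain ⟨δ, hδ, hh⟩ := hUC m₀ (m₀ - (m - i)) (by omega) ε hε
      exact ⟨δ, hδ, fun _ => hh⟩
    · exact ⟨1, one_pos, fun h' => absurd h' h⟩
  choose δf hδf hF using hmod
  refine ⟨(range (m + 1)).inf' ⟨0, by simp⟩ δf, (Finset.lt_inf'_iff _).2 fun j _ => hδf j, ?_⟩
  rintro ⟨k, U, X⟩ g hg g' hg' hagree hdiff
  dsimp only
  by_cases hX : T.r X ≤ k
  · rcases le_or_gt m (k - T.r X) with hm | hm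
    · -- a genuine level: the modulus at `(m, i)` itself
      rw [kingSection_of_le T hX hm, kingSection_of_le T hX hm, ← mul_sub, abs_mul, abs_of_pos (Real.exp_pos _)]
      have hδm : (range (m + 1)).inf' ⟨0, by simp⟩ δf ≤ δf m := Finset.inf'_le δf (mem_range.2 (by omega))
      have him : m - (m - i) = i := by omega
      exact hF m (by omega) (T.r X + m) _ X rfl g hg g' hg' (by rw [him]; exact hagree)
        (by rw [him]; exact hdiff.trans hδm)
    · -- above the top `m₀ = k − r X`: the top term on the history aged by `m − m₀`
      rw [kingSection_of_lt T hX hm, kingSection_of_lt T hX hm, ← mul_sub, abs_mul, abs_of_pos (Real.exp_pos _)]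
      by_cases hia : i < m - (k - T.r X)
      · -- the coordinate `i` is not read: the aged histories coincide
        have e : (fun j => g (j + (m - (k - T.r X)))) = fun j => g' (j + (m - (k - T.r X))) :=
          funext fun j => hagree _ (by omega)
        rw [e, sub_self, abs_zero, mul_zero]
        exact hε.le
      · -- read at the aged coordinate `i − (m − m₀) = m₀ − (m − i)`, run `k = r X + m₀`
        have hm₀a : m - i ≤ k - T.r X := by omega
        have hδ' : (range (m + 1)).inf' ⟨0, by simp⟩ δf ≤ δf (k - T.r X) := Finset.inf'_le δf (mem_range.2 (by omega))
        refine hF (k - T.r X) hm₀a k U X (by omega) _ (age_mem_boxWindow hg _) _ (age_mem_boxWindow hg' _)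
          (fun j hj => hagree _ (by omega)) ?_
        show |g (k - T.r X - (m - i) + (m - (k - T.r X))) - g' (k - T.r X - (m - i) + (m - (k - T.r X)))| ≤ δf (k - T.r X)
        rw [show k - T.r X - (m - i) + (m - (k - T.r X)) = i by omega]
        exact hdiff.trans hδ'
  · rw [kingSection_of_not_le T hX, kingSection_of_not_le T hX, sub_self, abs_zero]
    exact hε.le

/-! ## §2 The direct bracket at every domain of every run tends to zero with the scale, uniformly in the gap `n` -/

/-- **KING'S CURRENCY ON THE CARRIERS (E-side END, by name).**  `TowerNE5On T E I κ θ C₅` (`C₅ ≥ 0`, `0 ≤ θ < 1`) + prefix dependence +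
separate uniform continuity of every term in each young coupling, per scale, uniformly over the runs∕backgrounds∕domains of that scale + a
coordinatewise profile `P_i → 0` ⇒ for every `η > 0` ONE scale threshold `M₀`: for all runs `k`, gaps `n`, run-`(k+n)` backgrounds `U`, domains
`X` with scale `k − r X ≥ M₀` in run `k`, and admissible `g` (run `k + n`'s history, `n` unpaired couplings in front), `g'` (run `k`'s) with
`|g_{i+n} − g'_i| ≤ P_i` below the scale: `|E (k+n) g U X − E k g' (descend (k+n) U k) X| ≤ η·e^{−κd(X)}`.  NO modulus, NO constant, NO holomorphy.
[folklore] -/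
theorem directBracket_eventually_le_carriers {θ C₅ : ℝ} {P : ℕ → ℝ} (hC : 0 ≤ C₅) (hθ0 : 0 ≤ θ) (hθ1 : θ < 1)
    (h5 : TowerNE5On T E I κ θ C₅)
    (hP : ∀ (k : ℕ) (U : T.B) (X : T.Dom), ∀ g ∈ BoxWindow I, ∀ g' ∈ BoxWindow I,
      (∀ i, i < k - T.r X → g i = g' i) → E k g U X = E k g' U X)
    (hUC : ∀ m i : ℕ, i < m → ∀ ε : ℝ, 0 < ε → ∃ δ : ℝ, 0 < δ ∧ ∀ (k : ℕ) (U : T.B) (X : T.Dom), T.r X + m = k →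
      ∀ g ∈ BoxWindow I, ∀ g' ∈ BoxWindow I, (∀ j, j ≠ i → g j = g' j) → |g i - g' i| ≤ δ →
        Real.exp (κ * T.d X) * |E k g U X - E k g' U X| ≤ ε)
    (hd : Tendsto P atTop (𝓝 0)) {η : ℝ} (hη : 0 < η) :
    ∃ M₀ : ℕ, ∀ (k n : ℕ) (U : T.B) (X : T.Dom), T.r X + M₀ ≤ k →
      ∀ g ∈ BoxWindow I, ∀ g' ∈ BoxWindow I, (∀ i, i < k - T.r X → |g (i + n) - g' i| ≤ P i) →
        |E (k + n) g U X - E k g' (T.descend (k + n) U k) X| ≤ η * Real.exp (-(κ * T.d X)) := by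
  obtain ⟨M₀, hM⟩ := directBracket_eventually_le_family (σ := ℕ × T.B × T.Dom) (W := BoxWindow I)
    (F := fun s => kingSection T E κ s.1 s.2.1 s.2.2) hC hθ0 hθ1
    (fun g hg => shift_mem_boxWindow hg) (fun g hg g' hg' a => mix_mem_boxWindow hg hg' a)
    (fun s => kingSection_rate T hC hθ0 h5 s.1 s.2.1 s.2.2) (fun s => kingSection_prefix T hP s.1 s.2.1 s.2.2)
    (kingSection_sepUC T hUC) hd hη
  refine ⟨M₀, fun k n U X hk g hg g' hg' hgg' => ?_⟩
  have hX : T.r X ≤ k + n := by omega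
  have h := hM (k + n, U, X) (k - T.r X) (by omega) n g hg g' hg' hgg'
  dsimp only at h
  have e1 : kingSection T E κ (k + n) U X (k - T.r X + n) g = Real.exp (κ * T.d X) * E (k + n) g U X := by
    rw [kingSection_of_le T hX (by omega), show T.r X + (k - T.r X + n) = k + n by omega, T.descend_top]
  have e2 : kingSection T E κ (k + n) U X (k - T.r X) g' =
      Real.exp (κ * T.d X) * E k g' (T.descend (k + n) U k) X := by
    rw [kingSection_of_le T hX (by omega), show T.r X + (k - T.r X) = k by omega]
  rw [e1, e2, ← mul_sub, abs_mul, abs_of_pos (Real.exp_pos _)] at h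
  have h2 := (le_div_iff₀' (Real.exp_pos _)).mpr h
  rwa [div_eq_mul_inv, ← Real.exp_neg] at h2

/-! ## §3 A scale profile tending to zero, and node U6 in King's currency -/

/-- **THE SCALE PROFILE.**  Under the hypotheses of `directBracket_eventually_le_carriers` and a level-uniform (1.18)-type bound
`e^{κd(X)}·|E k g U X| ≤ B` (`B ≥ 0`) on the box, the supremum `b_j` of the normalised direct brackets over all runs, gaps, backgrounds, domains of
scale `j` and admissible pairs under `P` is a nonnegative profile with `b_j → 0` dominating every such bracket:
`|E (k+n) g U X − E k g' (descend (k+n) U k) X| ≤ b_{k − r X}·e^{−κd(X)}`.  This is the cutoff-free, n-uniform injection King's organisation of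
node U6 consumes. [folklore] -/
theorem exists_profile_carriers {θ C₅ B : ℝ} {P : ℕ → ℝ} (hC : 0 ≤ C₅) (hθ0 : 0 ≤ θ) (hθ1 : θ < 1)
    (h5 : TowerNE5On T E I κ θ C₅)
    (hP : ∀ (k : ℕ) (U : T.B) (X : T.Dom), ∀ g ∈ BoxWindow I, ∀ g' ∈ BoxWindow I,
      (∀ i, i < k - T.r X → g i = g' i) → E k g U X = E k g' U X)
    (hUC : ∀ m i : ℕ, i < m → ∀ ε : ℝ, 0 < ε → ∃ δ : ℝ, 0 < δ ∧ ∀ (k : ℕ) (U : T.B) (X : T.Dom), T.r X + m = k →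
      ∀ g ∈ BoxWindow I, ∀ g' ∈ BoxWindow I, (∀ j, j ≠ i → g j = g' j) → |g i - g' i| ≤ δ →
        Real.exp (κ * T.d X) * |E k g U X - E k g' U X| ≤ ε)
    (hB0 : 0 ≤ B) (hB : ∀ (k : ℕ) (U : T.B) (X : T.Dom), ∀ g ∈ BoxWindow I, Real.exp (κ * T.d X) * |E k g U X| ≤ B)
    (hd : Tendsto P atTop (𝓝 0)) :
    ∃ b : ℕ → ℝ, (∀ j, 0 ≤ b j) ∧ Tendsto b atTop (𝓝 0) ∧
      ∀ (k n : ℕ) (U : T.B) (X : T.Dom), T.r X ≤ k → ∀ g ∈ BoxWindow I, ∀ g' ∈ BoxWindow I,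
        (∀ i, i < k - T.r X → |g (i + n) - g' i| ≤ P i) →
          |E (k + n) g U X - E k g' (T.descend (k + n) U k) X| ≤ b (k - T.r X) * Real.exp (-(κ * T.d X)) := by
  -- the sets of normalised direct brackets at scale `j`, with `0` adjoined
  set S : ℕ → Set ℝ := fun j => insert 0 {x | ∃ (k n : ℕ) (U : T.B) (X : T.Dom) (g g' : ℕ → ℝ), T.r X + j = k ∧
      g ∈ BoxWindow I ∧ g' ∈ BoxWindow I ∧ (∀ i, i < k - T.r X → |g (i + n) - g' i| ≤ P i) ∧
      x = Real.exp (κ * T.d X) * |E (k + n) g U X - E k g' (T.descend (k + n) U k) X|} with hS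
  have hne : ∀ j, (S j).Nonempty := fun j => ⟨0, Set.mem_insert _ _⟩
  -- every element is at most `2B`
  have hle2B : ∀ j, ∀ x ∈ S j, x ≤ 2 * B := by
    intro j x hx
    rcases hx with rfl | ⟨k, n, U, X, g, g', -, hg, hg', -, rfl⟩
    · linarith
    · have h1 := hB (k + n) U X g hg
      have h2 := hB k (T.descend (k + n) U k) X g' hg'
      have hpos : 0 < Real.exp (κ * T.d X) := Real.exp_pos _
      calc Real.exp (κ * T.d X) * |E (k + n) g U X - E k g' (T.descend (k + n) U k) X|
          ≤ Real.exp (κ * T.d X) * (|E (k + n) g U X| + |E k g' (T.descend (k + n) U k) X|) :=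
            mul_le_mul_of_nonneg_left (abs_sub _ _) hpos.le
        _ ≤ 2 * B := by rw [mul_add]; linarith
  have hbdd : ∀ j, BddAbove (S j) := fun j => ⟨2 * B, hle2B j⟩
  refine ⟨fun j => sSup (S j), fun j => le_csSup (hbdd j) (Set.mem_insert _ _), ?_, ?_⟩
  · -- `b_j → 0`: beyond the threshold of `directBracket_eventually_le_carriers` at `η/2`, every element of `S j` is `≤ η/2`
    rw [Metric.tendsto_atTop]
    intro η hη
    obtain ⟨M₀, hM₀⟩ := directBracket_eventually_le_carriers T hC hθ0 hθ1 h5 hP hUC hd (half_pos hη)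
    refine ⟨M₀, fun j hj => ?_⟩
    have hbj : sSup (S j) ≤ η / 2 := by
      refine csSup_le (hne j) fun x hx => ?_
      rcases hx with rfl | ⟨k, n, U, X, g, g', hk, hg, hg', hgg', rfl⟩
      · exact (half_pos hη).le
      · have hpos : 0 < Real.exp (κ * T.d X) := Real.exp_pos _
        have h := hM₀ k n U X (by omega) g hg g' hg' hgg'
        calc Real.exp (κ * T.d X) * |E (k + n) g U X - E k g' (T.descend (k + n) U k) X|
            ≤ Real.exp (κ * T.d X) * (η / 2 * Real.exp (-(κ * T.d X))) := mul_le_mul_of_nonneg_left h hpos.le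
          _ = η / 2 := by rw [Real.exp_neg]; field_simp
    have hb0 : 0 ≤ sSup (S j) := le_csSup (hbdd j) (Set.mem_insert _ _)
    rw [Real.dist_eq, sub_zero, abs_of_nonneg hb0]
    linarith
  · -- domination
    intro k n U X hX g hg g' hg' hgg'
    have hpos : 0 < Real.exp (κ * T.d X) := Real.exp_pos _
    have hmem : Real.exp (κ * T.d X) * |E (k + n) g U X - E k g' (T.descend (k + n) U k) X| ∈ S (k - T.r X) :=
      Set.mem_insert_of_mem _ ⟨k, n, U, X, g, g', by omega, hg, hg', hgg', rfl⟩
    have h := le_csSup (hbdd _) hmem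
    have h2 := (le_div_iff₀' hpos).mpr h
    rwa [div_eq_mul_inv, ← Real.exp_neg] at h2

/-- **NODE U6 IN KING'S CURRENCY, FED BY NAME FROM THE CARRIERS.**  `TowerNE5On` + prefix dependence + separate uniform continuity per scale
(uniform over runs∕backgrounds∕domains) + the (1.18)-type bound + a family of run histories `t K ∈ BoxWindow I` with a nonnegative summable
K-uniform CONSECUTIVE matching profile `|t (K+1) (i+1) − t K i| ≤ p_i` (node U2): there is a scale profile `b_j → 0` with
`|E (K+n) (t (K+n)) U X − E K (t K) (descend (K+n) U K) X| ≤ b_{K − r X}·e^{−κd(X)}` for ALL `K`, `n`, `U`, `X`, and every injection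
`0 ≤ inj K j ≤ b_j` has `T4CauchySum.delta E₀ ρ inj K → 0` (`0 ≤ E₀`, `0 ≤ ρ < 1`) — the remainder `DirectPairingCauchy.cauchySeq_genFun_of_unif`
turns into `CauchySeq genFun`.  NO modulus, NO constant, NO holomorphy, NO `Summable`. [folklore] -/
theorem king_U6_of_carriers {θ C₅ B : ℝ} {p : ℕ → ℝ} {t : ℕ → ℕ → ℝ} (hC : 0 ≤ C₅) (hθ0 : 0 ≤ θ) (hθ1 : θ < 1)
    (h5 : TowerNE5On T E I κ θ C₅)
    (hP : ∀ (k : ℕ) (U : T.B) (X : T.Dom), ∀ g ∈ BoxWindow I, ∀ g' ∈ BoxWindow I,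
      (∀ i, i < k - T.r X → g i = g' i) → E k g U X = E k g' U X)
    (hUC : ∀ m i : ℕ, i < m → ∀ ε : ℝ, 0 < ε → ∃ δ : ℝ, 0 < δ ∧ ∀ (k : ℕ) (U : T.B) (X : T.Dom), T.r X + m = k →
      ∀ g ∈ BoxWindow I, ∀ g' ∈ BoxWindow I, (∀ j, j ≠ i → g j = g' j) → |g i - g' i| ≤ δ →
        Real.exp (κ * T.d X) * |E k g U X - E k g' U X| ≤ ε)
    (hB0 : 0 ≤ B) (hB : ∀ (k : ℕ) (U : T.B) (X : T.Dom), ∀ g ∈ BoxWindow I, Real.exp (κ * T.d X) * |E k g U X| ≤ B)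
    (ht : ∀ K, t K ∈ BoxWindow I) (hp : ∀ K i, |t (K + 1) (i + 1) - t K i| ≤ p i) (hp0 : ∀ i, 0 ≤ p i) (hps : Summable p) :
    ∃ b : ℕ → ℝ, (∀ j, 0 ≤ b j) ∧ Tendsto b atTop (𝓝 0) ∧
      (∀ (K n : ℕ) (U : T.B) (X : T.Dom), T.r X ≤ K →
        |E (K + n) (t (K + n)) U X - E K (t K) (T.descend (K + n) U K) X| ≤ b (K - T.r X) * Real.exp (-(κ * T.d X))) ∧
      ∀ (E₀ ρ : ℝ) (inj : ℕ → ℕ → ℝ), 0 ≤ E₀ → 0 ≤ ρ → ρ < 1 →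
        (∀ K j : ℕ, j ≤ K → 0 ≤ inj K j ∧ inj K j ≤ b j) → Tendsto (delta E₀ ρ inj) atTop (𝓝 0) := by
  obtain ⟨b, hb0, hb, hdom⟩ := exists_profile_carriers T (P := fun i => ∑' l, p (l + i)) hC hθ0 hθ1 h5 hP hUC hB0 hB (tendsto_tail p)
  refine ⟨b, hb0, hb, fun K n U X hX => hdom K n U X hX _ (ht _) _ (ht _) fun i _ => ?_,
    fun E₀ ρ inj hE₀ hρ hρ1 hinj => tendsto_delta_of_profile hE₀ hρ hρ1 hb0 hb hinj⟩
  have hp' : ∀ K i, |(fun K i => t K i) K i - (fun K i => t K i) (K + 1) (i + 1)| ≤ p i := fun K i => by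
    rw [abs_sub_comm]
    exact hp K i
  have h := abs_sub_le_tail_of_consecutive hp' hp0 hps n K i
  rw [abs_sub_comm] at h
  exact h

end Summit.QuantumFields.BalabanUV.T4Continuum.NE9.TowerCarriersKing
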